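import Literature.NumberTheory.GelbartRogawski1991.LocalDoubledUnitarySplitMixedModel   -- ★ §1 `leraySection_deltaLagrangian_apply_eq_conj_leviOpPi` (generic Levi value of Rao's section)
import Literature.NumberTheory.GelbartRogawski1991.LocalDoubledUnitarySplittingDataCM   -- ★ `localSplittingDatumCM`, `beta_parabolic`, `L1s_parabolic`
import Literature.NumberTheory.GelbartRogawski1991.LocalKudlaSplittingRigidity          -- ★ `MpPsi.toRep_conj_eq_of_implements`
import Literature.NumberTheory.GelbartRogawski1991.LocalDoubledBlockEmbedding            -- ★ `boxLoc`, `toOp_boxLoc` (Kudla's block implementer `j̃(p₁,p₂)`)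
import HarnessLib

/-!
# Crux `HLiu418`, #42S organ S1, (G) organ ROW (ρ-mid), step (M2a-C3-a): THE SIEGEL LEVI THROUGH AN IMPLEMENTER —
# `op(m) ∘ ω_v(s_v(p)) ∘ op(m)⁻¹ = ∏_w χ_w(det_Δ p_w) · |det B|^{-1/2} · (· ∘ B⁻¹)` whenever `π(m) ι(p) π(m)⁻¹ = m(B)`

Cell `hodgecm-mathlib`, crux item hLiu418 = `stmt-HodgeConjecture-24832`, route of record `HCCMUnconditional`; squad K2 ∕ K2Liu,
socket #42S (a), organ S1, (G) organ (K2Liu-p26 (g0) lead, K2Liu-p23 (g0) second hand; LEAD F0P6-plan (g14) BATCH #52 (3)).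
THEOREMS ONLY (no `def`, no `instance`, no `notation`, no named-fact hypothesis, no `sorry`); lane `--supports stmt-HodgeConjecture-24832`
(count-neutral helper).

WHAT.  For the CM local splitting datum `D_v = localSplittingDatumCM L v μ n hT₀ hT₀d hJD χ hχ` of the doubled unitary group
`H = U(T₀ ⊕ −T₀)` at ANY finite place `v` of `L⁺` (split or not) and ANY symmetric non-degenerate `T₀` (so in particular the block
datum `T₀ := T₁ ⊕ T₂` of ★ `LocalDoubledBlockEmbedding`), an element `m` of the local metaplectic group of pairs, ANY implementer `Γ`
of `π(m)`, a Siegel-parabolic `p ∈ P_Δ(F_v)` and `B ∈ GL_{n+n}(F_v)` with `π(m) ι(p) π(m)⁻¹ = m(B)` (the transported Siegel Levi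
of `Sp(𝕎^𝔻_v)` for `ℓ_Y`):

  `ω(m · s_v(p) · m⁻¹) Φ = (∏_w χ_w⁻¹(det_Δ p_w))⁻¹ • leviOpPi B Φ`,  `leviOpPi B Φ = |det B|^{-1/2} Φ(B⁻¹ ·)`

(`toRep_conj_localSplittingDatumCM_eq_smul_leviOpPi`), the same through the operator `op(m)` itself (`…_toOp`), and the
consumer's shape `op(m) (ω_v(p) (op(m)⁻¹ Ψ)) = … • leviOpPi B Ψ` (`toOp_localOmega_toOp_symm_eq_smul_leviOpPi`).  AT KUDLA'S BLOCK
IMPLEMENTER ((M2a-C2)∕(C3) of K2Liu-p26): instantiate `n := n₁ + n₂`, `T₀ := UnitaryGroup.finSum n₁ n₂ T₁ T₂`, `m := boxLoc L⁺ v n₁ n₂ (p₁, p₂)`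
(★ `boxLoc`; `op(j̃(p₁,p₂)) = op p₁ ⊠ op p₂` is ★ `toOp_boxLoc`, `rfl`), the hypothesis `hB` (`π(j̃) ι(p) π(j̃)⁻¹` IS a transported Levi)
being the consumer's geometric input BY VALUE.

HOW (all ★): `ω(m x m⁻¹) = Γ ∘ ω(x) ∘ Γ⁻¹` for any implementer `Γ` of `π(m)` (★ `MpPsi.toRep_conj_eq_of_implements`);
`ω_v(p) = β(p)⁻¹ • r(ι p)` (★ `localOmega_apply`); `β|_{P_Δ} = χ_v ∘ det_Δ` for the CM datum (★ `beta_parabolic` non-split,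
★ `L1s_parabolic` split: `localSplittingDatumCM_beta_of_isSiegelDelta`); and Rao's section at `ℓ_Δ` takes the value
`r(ι p) = Γ⁻¹ ∘ leviOpPi B ∘ Γ` (★ `leraySection_deltaLagrangian_apply_eq_conj_leviOpPi`, generic in the place; `ι p` fixes `ℓ_Δ`
is the DEFINITION of ★ `IsSiegelDelta`).  The `|det|`-exponent is leviOpPi's `−½` in `F_v`-currency; at `x = 0` this is ★
`localSplittingDatumCM_parabolic`'s `∏_w ‖det_Δ p_w‖_w^{1/2}`.
References: [Kudla1994] §3 Thm. 3.1; [HarrisKudlaSweet1996] §1 (1.15)–(1.16); [Rangarao1993] Thm 4.1, Lemma 5.1;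
[MoeglinVignerasWaldspurger1987] Chap. 2 II.1 (A), II.6.
HONEST LABEL.  Count-neutral helper; it retires nothing by itself: `HC_CM` is proved only modulo the 7 printed citations (2 remaining named inputs:
hLiu418 = `stmt-HodgeConjecture-24832`, h413 = `stmt-HodgeConjecture-24833`) until rung 0 closes.
-/

set_option autoImplicit false
set_option linter.dupNamespace false -- the mandated namespace repeats `HodgeConjecture.HodgeConjecture`

noncomputable section

open scoped Matrix
open NumberField IsDedekindDomain MeasureTheory Matrix
open Literature.RepresentationTheory.HeisenbergGroup Literature.RepresentationTheory.HeisenbergGroup.SymplecticMatrix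
open Literature.NumberTheory.Automorphic Literature.NumberTheory.Automorphic.UnitaryGroup Literature.NumberTheory.Weil1964
open Literature.NumberTheory.GaloisRepresentations Literature.NumberTheory.GaloisRepresentations.IsNonarchimedeanLocalField
open Literature.RepresentationTheory.HarrisKudlaSweet1996
open Literature.NumberTheory.GelbartRogawski1991.UnitaryDualPair
open Literature.NumberTheory.GelbartRogawski1991.UnitaryDualPair.LocalSplitting
open Literature.NumberTheory.GelbartRogawski1991.UnitaryDualPair.LocalSplitting.DoubledBlock

namespace Summit.HodgeConjecture.HodgeConjecture.Cruxes.HLiu418.K2LiuBlockImplementerLeviAction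

variable (L : Type) [Field L] [NumberField L] [IsCMField L] (v : HeightOneSpectrum (𝓞 (maximalRealSubfield L)))
  [MeasurableSpace (v.adicCompletion (maximalRealSubfield L))] [BorelSpace (v.adicCompletion (maximalRealSubfield L))]
  (μ : Measure (v.adicCompletion (maximalRealSubfield L))) [μ.IsAddHaarMeasure]
  (n : ℕ) {T₀ : Matrix (Fin n) (Fin n) (maximalRealSubfield L)} (hT₀ : T₀.IsSymm) (hT₀d : IsUnit T₀.det)
  {JD : Matrix (Fin (n + n)) (Fin (n + n)) L} (hJD : JD = (gramD (maximalRealSubfield L) n T₀).map (algebraMap (maximalRealSubfield L) L))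
  (χ : HeckeCharacter L) (hχ : IsSplittingChar L 1 χ)

/-! ## §1 Bookkeeping on the CM datum: its Leray section and its `β` on `P_Δ` -/

/-- the CM datum's section of implementers is Rao's `ℓ_Δ`-section `L0D` in both branches (split ∕ non-split). [cite: Kudla1994, Thm 3.1] -/
theorem localSplittingDatumCM_r :
    (localSplittingDatumCM L v μ n hT₀ hT₀d hJD χ hχ).r = (L0D (maximalRealSubfield L) v μ n hT₀d).r := by
  unfold localSplittingDatumCM
  split_ifs <;> rfl

/-- **`β|_{P_Δ} = χ_v ∘ det_Δ` for the CM datum** at every finite place (non-split ★ `beta_parabolic`, split ★ `L1s_parabolic`), with the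
tree's convention `χv w := (χ.localComponent w)⁻¹`. [cite: Kudla1994, Thm 3.1] [cite: HarrisKudlaSweet1996, §1 (1.15)] -/
theorem localSplittingDatumCM_beta_of_isSiegelDelta (p : UnitaryGroup.localPi L (IsCMField.complexConj L) (n + n) JD v)
    (hp : IsSiegelDelta (maximalRealSubfield L) L (IsCMField.complexConj L) (complexConj_imagUnit L) (imagUnit_ne_zero L)
      (imagUnit_mul_self L) v n hT₀ hJD p) :
    (localSplittingDatumCM L v μ n hT₀ hT₀d hJD χ hχ).beta p =
      chiDet (maximalRealSubfield L) L (IsCMField.complexConj L) v n (fun w' : PlacesOver L v => (χ.localComponent w'.1)⁻¹) p := by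
  unfold localSplittingDatumCM
  split_ifs with h
  · exact L1s_parabolic (maximalRealSubfield L) L (IsCMField.complexConj L) (complexConj_imagUnit L) (imagUnit_ne_zero L)
      (imagUnit_mul_self L) v μ n hT₀ hT₀d hJD h.choose h.choose_spec (L0D (maximalRealSubfield L) v μ n hT₀d).hψ' _
      (isSplitPair_localComponent_inv L v χ hχ h.choose h.choose_spec) p hp
  · exact beta_parabolic (maximalRealSubfield L) L (IsCMField.complexConj L) (complexConj_imagUnit L) (imagUnit_ne_zero L)
      (imagUnit_mul_self L) v μ n hT₀ hT₀d hJD _ _ _ _ _ p hp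

/-! ## §2 Rao's section on `P_Δ` through an implementer: the Levi value -/

/-- **the CM datum's `ℓ_Δ`-section on a Siegel-parabolic element is a conjugated Levi operator**: if `Γ` implements `E′ ∈ Sp(𝕎^𝔻_v)` and
`E′ ι(p) E′⁻¹ = m(B)`, then `r(ι p) Φ = Γ⁻¹ (leviOpPi B (Γ Φ))` (★ generic Levi value; `ι p` fixes `ℓ_Δ` is ★ `IsSiegelDelta` itself).
[cite: Rangarao1993, Thm 4.1, Lemma 5.1] [cite: MoeglinVignerasWaldspurger1987, Chap. 2 II.6] -/
theorem r_iotaD_eq_conj_leviOpPi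
    (E' : LocalSp (maximalRealSubfield L) (n + n) (gramD (maximalRealSubfield L) n T₀) v)
    (Γ : SchwartzBruhat (Fin (n + n) → v.adicCompletion (maximalRealSubfield L)) ≃ₗ[ℂ]
      SchwartzBruhat (Fin (n + n) → v.adicCompletion (maximalRealSubfield L)))
    (hΓ : Implements (localSchrodinger (maximalRealSubfield L) (n + n) (gramD (maximalRealSubfield L) n T₀) v) (ofSymplectic _ E') Γ)
    (p : UnitaryGroup.localPi L (IsCMField.complexConj L) (n + n) JD v)
    (hp : IsSiegelDelta (maximalRealSubfield L) L (IsCMField.complexConj L) (complexConj_imagUnit L) (imagUnit_ne_zero L)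
      (imagUnit_mul_self L) v n hT₀ hJD p)
    (B : GL (Fin (n + n)) (v.adicCompletion (maximalRealSubfield L)))
    (hB : E' * iotaD (maximalRealSubfield L) L (IsCMField.complexConj L) (complexConj_imagUnit L) (imagUnit_ne_zero L)
        (imagUnit_mul_self L) v n hT₀ hJD p * E'⁻¹ =
      transportSp (localGram (maximalRealSubfield L) (n + n) (gramD (maximalRealSubfield L) n T₀) v)
        (isUnit_det_localGram_gramD (maximalRealSubfield L) v n hT₀d) (levi B))
    (Φ : SchwartzBruhat (Fin (n + n) → v.adicCompletion (maximalRealSubfield L))) :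
    (localSplittingDatumCM L v μ n hT₀ hT₀d hJD χ hχ).r
        (iotaD (maximalRealSubfield L) L (IsCMField.complexConj L) (complexConj_imagUnit L) (imagUnit_ne_zero L)
          (imagUnit_mul_self L) v n hT₀ hJD p) Φ =
      Γ.symm (leviOpPi (glEquiv B) (Γ Φ)) := by
  rw [localSplittingDatumCM_r]
  exact leraySection_deltaLagrangian_apply_eq_conj_leviOpPi (maximalRealSubfield L) v μ n hT₀d
    (L0D (maximalRealSubfield L) v μ n hT₀d).hU (L0D (maximalRealSubfield L) v μ n hT₀d).r
    (fun g₁ g₂ => (L0D (maximalRealSubfield L) v μ n hT₀d).cocycle_eq g₁ g₂) E' Γ hΓ _ hp B hB Φ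

/-! ## §3 The operator statement: `ω(m s_v(p) m⁻¹) = χ_v(det_Δ p) · leviOpPi B` -/

/-- **(C3-a) THE SIEGEL LEVI THROUGH AN IMPLEMENTER.**  For the CM local splitting datum at any finite place, any `m ∈ S̃p_ψ(𝕎^𝔻_v)`, ANY
implementer `Γ` of `π(m)`, `p ∈ P_Δ(F_v)` and `B` with `π(m) ι(p) π(m)⁻¹ = m(B)`:
`ω(m · s_v(p) · m⁻¹) Φ = (∏_w χ_w⁻¹(det_Δ p_w))⁻¹ • leviOpPi B Φ` (`= ∏_w χ_w(det_Δ p_w) · |det B|^{-1/2} · Φ(B⁻¹ ·)`).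
[cite: Kudla1994, Thm 3.1] [cite: HarrisKudlaSweet1996, §1 (1.15)–(1.16)] [cite: MoeglinVignerasWaldspurger1987, Chap. 2 II.1 (A), II.6] -/
theorem toRep_conj_localSplittingDatumCM_eq_smul_leviOpPi
    (m : LocalMp (maximalRealSubfield L) (n + n) (gramD (maximalRealSubfield L) n T₀) v)
    (Γ : SchwartzBruhat (Fin (n + n) → v.adicCompletion (maximalRealSubfield L)) ≃ₗ[ℂ]
      SchwartzBruhat (Fin (n + n) → v.adicCompletion (maximalRealSubfield L)))
    (hΓ : Implements (localSchrodinger (maximalRealSubfield L) (n + n) (gramD (maximalRealSubfield L) n T₀) v)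
      (ofSymplectic _ (MpPsi.proj _ m)) Γ)
    (p : UnitaryGroup.localPi L (IsCMField.complexConj L) (n + n) JD v)
    (hp : IsSiegelDelta (maximalRealSubfield L) L (IsCMField.complexConj L) (complexConj_imagUnit L) (imagUnit_ne_zero L)
      (imagUnit_mul_self L) v n hT₀ hJD p)
    (B : GL (Fin (n + n)) (v.adicCompletion (maximalRealSubfield L)))
    (hB : MpPsi.proj _ m * iotaD (maximalRealSubfield L) L (IsCMField.complexConj L) (complexConj_imagUnit L) (imagUnit_ne_zero L)
        (imagUnit_mul_self L) v n hT₀ hJD p * (MpPsi.proj _ m)⁻¹ =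
      transportSp (localGram (maximalRealSubfield L) (n + n) (gramD (maximalRealSubfield L) n T₀) v)
        (isUnit_det_localGram_gramD (maximalRealSubfield L) v n hT₀d) (levi B))
    (Φ : SchwartzBruhat (Fin (n + n) → v.adicCompletion (maximalRealSubfield L))) :
    MpPsi.toRep (localSchrodinger (maximalRealSubfield L) (n + n) (gramD (maximalRealSubfield L) n T₀) v)
        (m * (localSplittingDatumCM L v μ n hT₀ hT₀d hJD χ hχ).localSplitting p * m⁻¹) Φ =
      ((chiDet (maximalRealSubfield L) L (IsCMField.complexConj L) v n
          (fun w' : PlacesOver L v => (χ.localComponent w'.1)⁻¹) p)⁻¹ : ℂˣ) • leviOpPi (glEquiv B) Φ := by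
  rw [MpPsi.toRep_conj_eq_of_implements _ (localSplittingDatumCM L v μ n hT₀ hT₀d hJD χ hχ).hU m _ Γ hΓ Φ]
  change Γ ((localSplittingDatumCM L v μ n hT₀ hT₀d hJD χ hχ).localOmega p (Γ.symm Φ)) = _
  rw [LocalSplittingDatum.localOmega_apply, localSplittingDatumCM_beta_of_isSiegelDelta L v μ n hT₀ hT₀d hJD χ hχ p hp,
    r_iotaD_eq_conj_leviOpPi L v μ n hT₀ hT₀d hJD χ hχ (MpPsi.proj _ m) Γ hΓ p hp B hB]
  simp only [Units.smul_def, map_smul, LinearEquiv.apply_symm_apply]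

/-- **(C3-a) through the operator `op(m)` itself** (`Γ := op(m)`, ★ `MpPsi.toRep_implements`).
[cite: Kudla1994, Thm 3.1] [cite: HarrisKudlaSweet1996, §1 (1.15)–(1.16)] -/
theorem toRep_conj_localSplittingDatumCM_eq_smul_leviOpPi_toOp
    (m : LocalMp (maximalRealSubfield L) (n + n) (gramD (maximalRealSubfield L) n T₀) v)
    (p : UnitaryGroup.localPi L (IsCMField.complexConj L) (n + n) JD v)
    (hp : IsSiegelDelta (maximalRealSubfield L) L (IsCMField.complexConj L) (complexConj_imagUnit L) (imagUnit_ne_zero L)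
      (imagUnit_mul_self L) v n hT₀ hJD p)
    (B : GL (Fin (n + n)) (v.adicCompletion (maximalRealSubfield L)))
    (hB : MpPsi.proj _ m * iotaD (maximalRealSubfield L) L (IsCMField.complexConj L) (complexConj_imagUnit L) (imagUnit_ne_zero L)
        (imagUnit_mul_self L) v n hT₀ hJD p * (MpPsi.proj _ m)⁻¹ =
      transportSp (localGram (maximalRealSubfield L) (n + n) (gramD (maximalRealSubfield L) n T₀) v)
        (isUnit_det_localGram_gramD (maximalRealSubfield L) v n hT₀d) (levi B))
    (Φ : SchwartzBruhat (Fin (n + n) → v.adicCompletion (maximalRealSubfield L))) :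
    MpPsi.toRep (localSchrodinger (maximalRealSubfield L) (n + n) (gramD (maximalRealSubfield L) n T₀) v)
        (m * (localSplittingDatumCM L v μ n hT₀ hT₀d hJD χ hχ).localSplitting p * m⁻¹) Φ =
      ((chiDet (maximalRealSubfield L) L (IsCMField.complexConj L) v n
          (fun w' : PlacesOver L v => (χ.localComponent w'.1)⁻¹) p)⁻¹ : ℂˣ) • leviOpPi (glEquiv B) Φ :=
  toRep_conj_localSplittingDatumCM_eq_smul_leviOpPi L v μ n hT₀ hT₀d hJD χ hχ m (MpPsi.toOp _ m) (MpPsi.toRep_implements _ m) p hp B hB Φ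

/-- **(C3-a) in words `op(m) (ω(s_v p) (op(m)⁻¹ Ψ)) = χ_v(det_Δ p) · leviOpPi B Ψ`** — the shape the (M2a-C2)∕(C3) consumer rewrites with
(`Ψ := op(m) Φ_ε`). [cite: Kudla1994, Thm 3.1] [cite: HarrisKudlaSweet1996, §1 (1.15)–(1.16)] -/
theorem toOp_localOmega_toOp_symm_eq_smul_leviOpPi
    (m : LocalMp (maximalRealSubfield L) (n + n) (gramD (maximalRealSubfield L) n T₀) v)
    (p : UnitaryGroup.localPi L (IsCMField.complexConj L) (n + n) JD v)
    (hp : IsSiegelDelta (maximalRealSubfield L) L (IsCMField.complexConj L) (complexConj_imagUnit L) (imagUnit_ne_zero L)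
      (imagUnit_mul_self L) v n hT₀ hJD p)
    (B : GL (Fin (n + n)) (v.adicCompletion (maximalRealSubfield L)))
    (hB : MpPsi.proj _ m * iotaD (maximalRealSubfield L) L (IsCMField.complexConj L) (complexConj_imagUnit L) (imagUnit_ne_zero L)
        (imagUnit_mul_self L) v n hT₀ hJD p * (MpPsi.proj _ m)⁻¹ =
      transportSp (localGram (maximalRealSubfield L) (n + n) (gramD (maximalRealSubfield L) n T₀) v)
        (isUnit_det_localGram_gramD (maximalRealSubfield L) v n hT₀d) (levi B))
    (Ψ : SchwartzBruhat (Fin (n + n) → v.adicCompletion (maximalRealSubfield L))) :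
    MpPsi.toOp _ m ((localSplittingDatumCM L v μ n hT₀ hT₀d hJD χ hχ).localOmega p ((MpPsi.toOp _ m).symm Ψ)) =
      ((chiDet (maximalRealSubfield L) L (IsCMField.complexConj L) v n
          (fun w' : PlacesOver L v => (χ.localComponent w'.1)⁻¹) p)⁻¹ : ℂˣ) • leviOpPi (glEquiv B) Ψ := by
  -- `ω(m s(p) m⁻¹) Ψ = op(m) (ω(s p) (op(m)⁻¹ Ψ))` (★), and the left side is computed by the `_toOp` form
  have h := MpPsi.toRep_conj_eq_of_implements _ (localSplittingDatumCM L v μ n hT₀ hT₀d hJD χ hχ).hU m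
    ((localSplittingDatumCM L v μ n hT₀ hT₀d hJD χ hχ).localSplitting p) (MpPsi.toOp _ m) (MpPsi.toRep_implements _ m) Ψ
  exact h.symm.trans (toRep_conj_localSplittingDatumCM_eq_smul_leviOpPi_toOp L v μ n hT₀ hT₀d hJD χ hχ m p hp B hB Ψ)

end Summit.HodgeConjecture.HodgeConjecture.Cruxes.HLiu418.K2LiuBlockImplementerLeviAction

end
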